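import Literature.Probability.LatticeModels.LupuCouplingAnnealed
import Literature.Probability.Percolation.NewmanSchulman
import HarnessLib

/-!
# Lupu's coupling: three infinite clusters of the same sign make a cut-ball

Topic `Literature/Probability/LatticeModels`. Brick 10 of the proof of
`Literature.Probability.LatticeModels.Lupu2016_cableSignClustersBounded` (Lupu 2016, Prop. 5.5).
Lupu's Lemma 5.3 obtains the uniqueness of the infinite cluster of `ω` from Gandolfi–Keane–Newman
(translation invariance + positive finite energy, i.e. Burton–Keane). Positive finite energy
across clusters of OPPOSITE signs rests on the sign-independence of infinite clusters (Thm. 1 bis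
in infinite volume, via the loop-soup limit), which we avoid; the part of Burton–Keane that the
proof of Prop. 5.5 given in these files needs is only "`N = ∞` is impossible", and for that it
suffices to create cut-balls (trifurcations) out of three infinite clusters OF THE SAME SIGN,
which a Cameron–Martin shift of the free field does. This file supplies the two deterministic
ingredients on the joint space `(φ, U)` of `LupuCouplingAnnealed.lean`:

* `threeSignedInBox s r` — three distinct infinite clusters of sign `s ∈ {±1}` meet `Λ_r`; and
  `numInfiniteClusters = ⊤ ⟹ ⋃_{s,r} threeSignedInBox s r` on the full-measure set of good
  points (positive labels, non-vanishing field): among five infinite clusters three have the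
  same sign (`subset_iUnion_threeSignedInBox_of_numInfiniteClusters_eq_top`, using the tree's
  `atLeastInfClusters`);
* `symConfig_add_boxShift_mem_cutBall` — on `threeSignedInBox s r ∩ {|φ| ≤ t/2 on Λ_r} ∩
  {U ≤ 1 - e^{-t²/2} on ℰ_{Λ_r}}`, adding `s t · 1_{Λ_r}` to the field turns the configuration
  into a cut-ball at `0` of radius `r` (the tree's `cutBall`/`IsCutSet` of the Burton–Keane
  proof, Bollobás–Riordan 2006, Ch. 5): all bonds of the box open, and the three same-sign
  branches, untouched off the box (`determinedBy_openConnVia`, `determinedBy_percolatesVia`),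
  stay attached to it through bonds whose weight only increased.

References: T. Lupu, Ann. Probab. 44 (2016), Lemma 5.3, Prop. 5.5 [`Lupu2016`]; B. Bollobás,
O. Riordan, *Percolation* (2006), Ch. 5, proof of Thm. 4 [`BollobasRiordan2006`] (cut-balls, as
formalised in `UniquenessInfiniteCluster.lean`).
-/

noncomputable section

namespace Literature.Probability.LatticeModels

open _root_.MeasureTheory _root_.ProbabilityTheory Finset Filter Literature.Probability.Percolation
  SimpleGraph
open scoped ENNReal NNReal

variable {d : ℕ}

/-! ### Good points and three same-sign infinite clusters in a box -/

/-- The **good points** of the joint space: all labels are positive and the field vanishes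
nowhere (a set of full measure). [folklore] -/
def goodSet (d : ℕ) : Set ((Site d → ℝ) × Labels d) :=
  {p | (∀ e, 0 < p.2 e) ∧ ∀ x, p.1 x ≠ 0}

/-- **Three distinct infinite clusters of sign `s` meet the box `Λ_r`** — the auxiliary event of
the Burton–Keane trifurcation argument used here in place of Lupu's Lemma 5.3. [folklore] -/
def threeSignedInBox (s : ℝ) (r : ℕ) : Set ((Site d → ℝ) × Labels d) :=
  {p | ∃ w : Fin 3 → Site d, (∀ i, w i ∈ box d r) ∧
    (∀ i, symConfig p.1 p.2 ∈ percolatesAt (w i)) ∧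
    (∀ i j, (openGraph (symConfig p.1 p.2)).Reachable (w i) (w j) → i = j) ∧
    ∀ i, 0 < s * p.1 (w i)}

/-- From three distinct vertices with a common property we get an injective `Fin 3`-family.
[folklore] -/
theorem exists_fin_three_of_card_eq_three {α : Type*} [DecidableEq α] {s : Finset α}
    (hs : s.card = 3) : ∃ w : Fin 3 → α, Function.Injective w ∧ ∀ i, w i ∈ s := by
  obtain ⟨x, y, z, hxy, hxz, hyz, rfl⟩ := Finset.card_eq_three.1 hs
  refine ⟨![x, y, z], ?_, ?_⟩
  · intro i j h
    fin_cases i <;> fin_cases j <;> simp_all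
  · intro i
    fin_cases i <;> simp

/-- **`N = ∞` forces three infinite clusters of the same sign in some box** (on good points):
among five pairwise disjoint infinite clusters (the tree's `atLeastInfClusters 5`) three of their
base points carry the same sign of `φ` (pigeonhole). [folklore] -/
theorem subset_iUnion_threeSignedInBox_of_numInfiniteClusters_eq_top :
    {p : (Site d → ℝ) × Labels d | numInfiniteClusters (symConfig p.1 p.2) = ⊤} ∩ goodSet d ⊆
      ⋃ r : ℕ, (threeSignedInBox 1 r ∪ threeSignedInBox (-1) r) := by
  classical
  rintro ⟨φ, U⟩ ⟨hN, -, hφ⟩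
  have hN : numInfiniteClusters (symConfig φ U) = ⊤ := hN
  have h5 : symConfig φ U ∈ atLeastInfClusters (Site d) 5 := by
    rw [mem_atLeastInfClusters_iff, hN]; exact le_top
  obtain ⟨s, hcard, hperc, hpair⟩ := h5
  -- signs
  set sp := s.filter (fun x => 0 < φ x) with hsp
  set sn := s.filter (fun x => φ x < 0) with hsn
  have hunion : sp.card + sn.card = 5 := by
    rw [← hcard, ← Finset.card_union_of_disjoint, ← Finset.filter_or]
    · congr 1
      ext x
      simp only [Finset.mem_filter, and_iff_left_iff_imp]
      exact fun _ => (hφ x).lt_or_gt.symm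
    · rw [Finset.disjoint_filter]
      exact fun x _ h h' => lt_asymm h h'
  -- one of the two sign classes has at least three elements
  have hthree : ∃ (σ : ℝ) (t : Finset (Site d)), t ⊆ s ∧ t.card = 3 ∧ ∀ x ∈ t, 0 < σ * φ x ∧ (σ = 1 ∨ σ = -1) := by
    by_cases h3 : 3 ≤ sp.card
    · obtain ⟨t, ht, htc⟩ := Finset.exists_subset_card_eq h3
      refine ⟨1, t, ht.trans (Finset.filter_subset _ _), htc, fun x hx => ⟨?_, Or.inl rfl⟩⟩
      have := (Finset.mem_filter.1 (ht hx)).2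
      linarith
    · have h3' : 3 ≤ sn.card := by omega
      obtain ⟨t, ht, htc⟩ := Finset.exists_subset_card_eq h3'
      refine ⟨-1, t, ht.trans (Finset.filter_subset _ _), htc, fun x hx => ⟨?_, Or.inr rfl⟩⟩
      have := (Finset.mem_filter.1 (ht hx)).2
      linarith
  obtain ⟨σ, t, hts, htc, hsign⟩ := hthree
  obtain ⟨w, hwinj, hwt⟩ := exists_fin_three_of_card_eq_three htc
  -- a common box
  obtain ⟨r, hr⟩ : ∃ r : ℕ, ∀ i : Fin 3, w i ∈ box d r :=
    ((Finset.univ.eventually_all).2 fun i _ => eventually_mem_box (w i)).exists.imp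
      fun r h i => h i (Finset.mem_univ i)
  have hmem : (φ, U) ∈ threeSignedInBox (d := d) σ r := by
    refine ⟨w, hr, fun i => hperc _ (hts (hwt i)), fun i j hij => ?_, fun i => (hsign _ (hwt i)).1⟩
    by_contra hne
    exact hpair (hts (hwt i)) (hts (hwt j)) (fun h => hne (hwinj h)) hij
  refine Set.mem_iUnion.2 ⟨r, ?_⟩
  rcases (hsign _ (hwt 0)).2 with h | h
  · exact Or.inl (h ▸ hmem)
  · exact Or.inr (h ▸ hmem)

/-! ### The cut-ball produced by a same-sign field shift -/

/-- Off the box the shifted field is the field. [folklore] -/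
theorem add_boxShift_apply_of_not_mem {K : Finset (Site d)} (φ : Site d → ℝ) (t : ℝ) {x : Site d}
    (hx : x ∉ K) : (φ + IsDiscreteGFF.boxShift K t) x = φ x := by
  simp [IsDiscreteGFF.boxShift, hx]

/-- On the box the shifted field is `φ + t`. [folklore] -/
theorem add_boxShift_apply_of_mem {K : Finset (Site d)} (φ : Site d → ℝ) (t : ℝ) {x : Site d}
    (hx : x ∈ K) : (φ + IsDiscreteGFF.boxShift K t) x = φ x + t := by
  simp [IsDiscreteGFF.boxShift, hx]

/-- The symmetric weights are monotone in the positive part of the product of the endpoint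
values. [folklore] -/
theorem coe_symWeight_mono {φ₁ φ₂ : Site d → ℝ} {a b : Site d} (hadj : (zdGraph d).Adj a b)
    (h : max (φ₁ a * φ₁ b) 0 ≤ max (φ₂ a * φ₂ b) 0) :
    (symWeight φ₁ s(a, b) : ℝ) ≤ symWeight φ₂ s(a, b) := by
  rw [coe_symWeight_of_adj _ hadj, coe_symWeight_of_adj _ hadj]
  have := Real.exp_le_exp.2 (show -2 * max (φ₂ a * φ₂ b) 0 ≤ -2 * max (φ₁ a * φ₁ b) 0 by linarith)
  linarith

/-- Bonds with both endpoints off `K` keep their weight under the box shift, so the shifted and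
unshifted configurations agree on the edges of the step graph avoiding `K`. [folklore] -/
theorem symConfig_add_boxShift_inter_eq {K : Finset (Site d)} (φ : Site d → ℝ) (U : Labels d) (t : ℝ) :
    symConfig (φ + IsDiscreteGFF.boxShift K t) U ∩ (withinGraph ⊤ (↑K : Set (Site d))ᶜ).edgeSet =
      symConfig φ U ∩ (withinGraph ⊤ (↑K : Set (Site d))ᶜ).edgeSet := by
  ext e
  induction e using Sym2.ind with
  | _ a b =>
    simp only [Set.mem_inter_iff, mem_edgeSet_withinGraph, Set.mem_compl_iff, Finset.mem_coe,
      symConfig, Set.mem_setOf_eq]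
    constructor
    · rintro ⟨h, hab, ha, hb⟩
      rw [symWeight_mk_congr (add_boxShift_apply_of_not_mem φ t ha)
        (add_boxShift_apply_of_not_mem φ t hb)] at h
      exact ⟨h, hab, ha, hb⟩
    · rintro ⟨h, hab, ha, hb⟩
      rw [← symWeight_mk_congr (add_boxShift_apply_of_not_mem φ t ha)
        (add_boxShift_apply_of_not_mem φ t hb)] at h
      exact ⟨h, hab, ha, hb⟩

/-- **The same-sign field shift produces a cut-ball** (`t > 0`, `s = ±1`): if three distinct
infinite clusters of sign `s` meet `Λ_r`, `|φ| ≤ t/2` on `Λ_r` and the labels of the bonds of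
`Λ_r` are `≤ 1 - e^{-t²/2}`, then after adding `s t` to the field on `Λ_r` the configuration is a
cut-ball at `0` of radius `r`: every bond of `Λ_r` is open (`s φ' ≥ t/2` on the box), and the three
branches given by `exists_branch_of_percolatesAt` survive — off the box nothing changed, and the
attaching bonds `{k, a}` (`k ∈ Λ_r`, `a ∉ Λ_r` of sign `s`) only got a larger weight.
(The configuration-theoretic step "open the ball" of Bollobás–Riordan 2006, Ch. 5, proof of
Thm. 4, here realised by a Cameron–Martin shift of the Gaussian field.) [cite: BollobasRiordan2006, Ch. 5, proof of Thm. 4 (p. 107)] -/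
theorem symConfig_add_boxShift_mem_cutBall {φ : Site d → ℝ} {U : Labels d} {s t : ℝ} {r : ℕ}
    (hs : s = 1 ∨ s = -1) (ht : 0 < t) (hgood : (φ, U) ∈ goodSet d)
    (hthree : (φ, U) ∈ threeSignedInBox (d := d) s r) (hφ : ∀ x ∈ box d r, |φ x| ≤ t / 2)
    (hU : ∀ e ∈ edgesIn (zdGraph d) (box d r), U e ≤ 1 - Real.exp (-(t ^ 2) / 2)) :
    symConfig (φ + IsDiscreteGFF.boxShift (box d r) (s * t)) U ∈ cutBall (0 : Site d) r := by
  classical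
  obtain ⟨hUpos, hφne⟩ := hgood
  obtain ⟨w, hwK, hperc, hdis, hsign⟩ := hthree
  dsimp only at hUpos hφne hperc hdis hsign
  have hs2 : s * s = 1 := by rcases hs with rfl | rfl <;> norm_num
  set K : Finset (Site d) := box d r with hK
  set ω : BondConfig (Site d) := symConfig φ U with hω
  set φ' : Site d → ℝ := φ + IsDiscreteGFF.boxShift K (s * t) with hφ'
  have hωE : ω ⊆ (zdGraph d).edgeSet := symConfig_subset_edgeSet hUpos
  -- signs propagate along open paths from the `w i`
  have hsign_of_reach : ∀ i a, (openGraph ω).Reachable (w i) a → 0 < s * φ a := by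
    intro i a hreach
    have hwne : φ (w i) ≠ 0 := fun h0 => by
      have := hsign i; rw [h0, mul_zero] at this; exact lt_irrefl _ this
    have h1 : 0 < φ (w i) * φ a := reachable_symConfig_mul_pos hUpos hreach hwne
    have h2 : 0 < (s * φ (w i)) * (φ (w i) * φ a) := mul_pos (hsign i) h1
    have key : (s * φ (w i)) * (φ (w i) * φ a) = (s * φ a) * (φ (w i) * φ (w i)) := by ring
    rw [key] at h2
    exact (pos_iff_pos_of_mul_pos h2).2 (mul_self_pos.2 hwne)
  -- on the box, `s φ' ≥ t / 2`
  have hbox : ∀ x ∈ K, t / 2 ≤ s * φ' x := by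
    intro x hx
    rw [hφ', add_boxShift_apply_of_mem φ (s * t) hx]
    have habs := hφ x hx
    have h1 : -(t / 2) ≤ s * φ x := by
      rcases hs with rfl | rfl
      · have := neg_abs_le (φ x); linarith
      · have := le_abs_self (φ x); linarith
    nlinarith
  change IsCutSet (zdGraph d) (Percolation.shiftedBox 0 r) _
  rw [Percolation.shiftedBox_zero]
  -- the branches, from the unshifted configuration
  choose a haK hadj hreach hpv using fun i => exists_branch_of_percolatesAt K hωE (hwK i) (hperc i)
  have hagree := symConfig_add_boxShift_inter_eq (K := K) φ U (s * t)
  refine ⟨?_, a, haK, fun i => ?_, fun i j hij => ?_, fun i => ?_⟩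
  · -- every bond of the box is open
    intro e he
    induction e using Sym2.ind with
    | _ x y =>
      rw [Finset.mem_coe, mem_edgesIn_iff] at he
      have hadjxy : (zdGraph d).Adj x y := (SimpleGraph.mem_edgeSet _).1 he.1
      have hx : x ∈ K := he.2 x (Sym2.mem_mk_left x y)
      have hy : y ∈ K := he.2 y (Sym2.mem_mk_right x y)
      change U s(x, y) ≤ (symWeight φ' s(x, y) : ℝ)
      rw [coe_symWeight_of_adj _ hadjxy]
      have hprod : t ^ 2 / 4 ≤ φ' x * φ' y := by
        have h1 := hbox x hx; have h2 := hbox y hy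
        have : (s * φ' x) * (s * φ' y) = φ' x * φ' y := by
          calc (s * φ' x) * (s * φ' y) = (s * s) * (φ' x * φ' y) := by ring
            _ = φ' x * φ' y := by rw [hs2, one_mul]
        rw [← this]; nlinarith
      have hmax : t ^ 2 / 4 ≤ max (φ' x * φ' y) 0 := hprod.trans (le_max_left _ _)
      have hexp : Real.exp (-2 * max (φ' x * φ' y) 0) ≤ Real.exp (-(t ^ 2) / 2) :=
        Real.exp_le_exp.2 (by linarith)
      have := hU s(x, y) (mem_edgesIn_iff.2 he)
      linarith
  · -- the attaching bond `{k, a i}` is still open: its weight only increased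
    obtain ⟨k, hk, hka⟩ := hadj i
    refine ⟨k, hk, ?_⟩
    rw [openGraph_adj] at hka ⊢
    refine ⟨?_, hka.2⟩
    have hka' : U s(k, a i) ≤ (symWeight φ s(k, a i) : ℝ) := hka.1
    have hadjka : (zdGraph d).Adj k (a i) := (SimpleGraph.mem_edgeSet _).1 (hωE hka.1)
    change U s(k, a i) ≤ (symWeight φ' s(k, a i) : ℝ)
    refine hka'.trans (coe_symWeight_mono hadjka (max_le_max ?_ le_rfl))
    rw [hφ', add_boxShift_apply_of_mem φ _ hk, add_boxShift_apply_of_not_mem φ _ (haK i)]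
    have hsa : 0 < s * φ (a i) := hsign_of_reach i (a i) (hreach i)
    nlinarith
  · -- distinct branches stay distinct: nothing changed off the box
    have hij' : ω ∈ openConnVia (withinGraph ⊤ (↑K : Set (Site d))ᶜ) (a i) (a j) :=
      ((determinedBy_iff _ _).1 (determinedBy_openConnVia _ (a i) (a j)) _ ω hagree).1 hij
    have hreach_ij : (openGraph ω).Reachable (a i) (a j) := by
      have : a j ∈ openClusterIn (withinGraph ⊤ (↑K : Set (Site d))ᶜ) ω (a i) := hij'
      exact openClusterIn_subset_openCluster _ ω (a i) this
    exact hdis i j (((hreach i).trans hreach_ij).trans (hreach j).symm)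
  · -- the branches still percolate off the box
    exact ((determinedBy_iff _ _).1 (determinedBy_percolatesVia _ (a i)) _ ω hagree).2 (hpv i)

end Literature.Probability.LatticeModels
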